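import Summits.BirchSwinnertonDyer.BirchSwinnertonDyer.Theorems.AdditiveKolyvaginRoadKolyvaginJump
import Summits.BirchSwinnertonDyer.BirchSwinnertonDyer.Theorems.AdditiveKolyvaginRoadKolyvaginSignedSupply
import Summits.BirchSwinnertonDyer.BirchSwinnertonDyer.Theorems.AdditiveKolyvaginRoadKolyvaginIsoBound
import Summits.BirchSwinnertonDyer.BirchSwinnertonDyer.Theorems.AdditiveKolyvaginRoadLocalPackageOfSupply
import Summits.BirchSwinnertonDyer.BirchSwinnertonDyer.Theorems.AdditiveKolyvaginRoadLocalPackageOfKolyvaginPrime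
import HarnessLib

/-!
# Route `AdditiveKolyvaginRoad`, crux `KolyvaginPrimitiveAdditive` (item stmt-BirchSwinnertonDyer-20132), stub LOC:
# (Supply) — W. Zhang's Lemma 8.2 for the level structure at a general odd prime `p` — FROM THE POITOU–TATE FACT,
# and the LOCAL–GLOBAL PACKAGE `KolyvaginLocalPackageP` modulo that fact
# (p-generic port of koly3b's `…ZhangSupplyOfPoitouTate` §6, the ASSEMBLY; ordinary ↦ TORIC, `GoodLevel` dropped)
# (cell `pub/bsd-wall`, lead prover `bsd-wall-akr-p1` g4; `--supports stmt-BirchSwinnertonDyer-20132`, helper)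

WHAT.
* `hSupply_of_poitouTateP` — the body of `KolyvaginLocalPackageP.supply` in `plK` currency (koly3b XXV shape): for
  every non-empty Bertolini–Darmon admissible level `n`, Kolyvagin `ℓ ∉ T`, sign `s`, a NON-ZERO `s`-eigenclass of
  complex conjugation, Kummer at `∞` and at the finite places off `λ ∪ plK(T) ∪ {v ∣ n}`, TORIC above `n`, TRANSVERSE on
  `plK(T)`. Assembly = `supply_signed_of_jump_boundP` (akr-p1 g4) over the genuine localisations, `b_v = inv_v ∘ ∪ₑ` for
  a Weil pairing and the Poitou–Tate family of the totally complex `K` (tree THEOREM; akr-p1 g3's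
  `exists_zmodBilinear_invCupProduct_P`, (REC) `sum_invCupProduct_eq_zero_P`, Kummer ∕ TORIC isotropy
  `invCupProduct_eq_zero_of_mem_kummer_P` ∕ `…_toric_P`, (Tr-iso) `cupProduct_eq_zero_of_mem_transverseLocalKerP`), with
  (J) `hjump := hjump_of_poitouTateP` (g4, CONDITIONAL on the named PT fact) and (IsoBound) `hbound` from g3's
  `sub_zsmul_mem_torsionLocalKer_of_isotropic_P` (p546163) by the injectivity of `inv_λ`.
* `supply_of_poitouTateP` — the same in the PLACE currency of `KolyvaginLocalPackageP.supply` (`plK ℓ := (ℓ)`, the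
  unique place above the inert `ℓ`).
* `kolyvaginLocalPackageP_of_poitouTate` — **stub LOC modulo the Poitou–Tate fact**:
  `Nonempty (KolyvaginLocalPackageP W K p ι c)` at a ♯-type frame (`K` imaginary quadratic with `d_K < −4`, `p` odd,
  `ρ̄_{E,p}` onto, `c ≠ 1`) from `poitouTate_selmerStructure_duality K` ALONE (g3's `kolyvaginLocalPackageP_of_supply`,
  p540947, fed with `supply_of_poitouTateP`).

HONEST FRAMING: theorems only; 0 definitions, 0 named facts, 0 `sorry`; CONDITIONAL on the named Poitou–Tate fact
`Literature.NumberTheory.GaloisCohomology.poitouTate_selmerStructure_duality K` (Milne ADT I Thm. 4.10; Rubin Thm. 1.7.3;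
item PublishedDualityInputsAdditiveKoly of the route) and on `NumberField.discr K < -4` (the order `ℓ + 1` of the Kolyvagin
character, akr-p1 g3 `exists_kolyvagin_character_P`; part of the crux's frame since route rev 20, R-K4). It is the registered
stub LOC of skeleton v9 (crux re-typed as stmt-BirchSwinnertonDyer-21400) MODULO the PT fact; the discharge from the route's
item `PublishedDualityInputsAdditiveKoly` happens in the composition item 21266. Closes nothing by itself.

References: [cite: WZhang2014, §8.1, Lemma 8.2, Lemma 8.4] [cite: McCallumLMS1991, Prop. 2.1, Lemma 5.3]
[cite: MilneADT2006, Ch. I, Cor. 2.3, Thm. 4.10] [cite: GrossLMS1991, Prop. 8.1–8.2] [cite: BertoliniDarmon2005, §2.2–§2.3].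
-/

-- single-conjunct summit: `Summit.BirchSwinnertonDyer.BirchSwinnertonDyer.…` repeats the name by design
set_option linter.dupNamespace false

noncomputable section

open scoped Classical Pointwise

namespace Summit.BirchSwinnertonDyer.BirchSwinnertonDyer.Theorems.AdditiveKoly

open CategoryTheory WeierstrassCurve Field Function NumberField IsDedekindDomain
open Literature.NumberTheory.EllipticCurves Literature.NumberTheory.EllipticCurves.ModularForms
  Literature.NumberTheory.GaloisRepresentations Module
open Literature.NumberTheory.GaloisCohomology
open Summit.BirchSwinnertonDyer.Rank1Residual.X11b.Three.Koly.Method2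
open Summit.BirchSwinnertonDyer.Rank1Residual.X11b.Three.Koly.ZhangSupply
open scoped ContRepresentation

variable (W : WeierstrassCurve ℚ) (K : Type) [Field K] [NumberField K] (p : ℕ) [W.IsElliptic] [W.IsGloballyMinimal]
  [Fact p.Prime] (ι : K →+* ℂ) (c : K ≃ₐ[ℚ] K)
  [Module (ZMod p) (Vp W K p)]
  [∀ v : Place K, Module (ZMod p)
    (galoisCohomology (((W.baseChange K).torsionGaloisModule ((p ^ 1 : ℕ) : ℤ)).toLocal v) 1)]
  [∀ v : Place K, CompactSpace (absoluteGaloisGroup (Place.Completion v))]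
  [Finite (geomTorsion (W.baseChange K) ((p ^ 1 : ℕ) : ℤ))]

/-! ## §1 (Supply) in `plK` currency from the Poitou–Tate fact -/

/-- **W. Zhang's Lemma 8.2 for the level structure at a general odd prime, from the Poitou–Tate fact** (`plK`
currency). Frame: `K` imaginary quadratic with `d_K < −4`, `p` odd, `ρ̄_{E,p}` onto, complex conjugation `c ≠ 1`; the
named PT fact `hPT`; the places `plK` of the Kolyvagin primes (`hplK`). For every non-empty admissible level `n`,
Kolyvagin `ℓ ∉ T` and sign `s`: a non-zero `s`-eigenclass with E's Kummer condition at `∞` and off `λ ∪ plK(T) ∪ {v ∣ n}`,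
TORIC above `n`, TRANSVERSE on `plK(T)`. [cite: WZhang2014, Lemma 8.2] [cite: McCallumLMS1991, Prop. 2.1]
[cite: MilneADT2006, Ch. I, Cor. 2.3, Thm. 4.10] -/
theorem hSupply_of_poitouTateP (hK : IsImaginaryQuadratic K) (hp2 : p ≠ 2) (hd : NumberField.discr K < -4)
    (hsurj : W.HasSurjectiveModNGaloisRep p) (hc : c ≠ 1) (hPT : poitouTate_selmerStructure_duality K)
    (plK : {ℓ // Zhang2014.IsKolyvaginPrime (W.conductorNorm ℤ) W K p ℓ} → HeightOneSpectrum (𝓞 K))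
    (hplK : ∀ ℓ, ((ℓ : ℕ) : 𝓞 K) ∈ (plK ℓ).asIdeal) :
    ∀ (n : Finset (AdmQ W K p)), n.Nonempty →
      ∀ (ℓ : {ℓ // Zhang2014.IsKolyvaginPrime (W.conductorNorm ℤ) W K p ℓ}) (T : Finset _), ℓ ∉ T →
      ∀ s : Bool, ∃ x : Vp W K p, conjAct W c ((p ^ 1 : ℕ) : ℤ) x = sgnP s • x ∧ x ≠ 0 ∧
        (∀ w : InfinitePlace K, x ∈ selmerLocalKer (W.baseChange K) w.Completion ((p ^ 1 : ℕ) : ℤ)) ∧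
        (∀ v : HeightOneSpectrum (𝓞 K), v ≠ plK ℓ → (∀ ℓ' ∈ T, plK ℓ' ≠ v) →
          ((∀ q ∈ n, ((q : ℕ) : 𝓞 K) ∉ v.asIdeal) →
            x ∈ selmerLocalKer (W.baseChange K) (v.adicCompletion K) ((p ^ 1 : ℕ) : ℤ)) ∧
          (∀ q ∈ n, ((q : ℕ) : 𝓞 K) ∈ v.asIdeal →
            x ∈ toricLocalKer (W.baseChange K) (v.adicCompletion K) ((p ^ 1 : ℕ) : ℤ))) ∧
        (∀ ℓ' ∈ T, x ∈ transverseLocalKerP W K p ι ℓ' (plK ℓ')) := by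
  have hp : p.Prime := Fact.out
  haveI : IsTotallyComplex K := hK.2
  haveI : NeZero (p ^ 1 : ℕ) := ⟨pow_ne_zero 1 hp.ne_zero⟩
  -- the localisations (as `ZMod p`-linear maps), a Weil pairing, the Poitou–Tate family, the local forms
  let ρ := (W.baseChange K).torsionGaloisModule ((p ^ 1 : ℕ) : ℤ)
  let loc : (v : Place K) → Vp W K p →ₗ[ZMod p] galoisCohomology (ρ.toLocal v) 1 := fun v ↦
    (show Vp W K p →+ galoisCohomology (ρ.toLocal v) 1 from galoisCohomology.localization ρ v 1).toZModLinearMap p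
  have hloc : ∀ (v : Place K) (x : Vp W K p), loc v x = galoisCohomology.localization ρ v 1 x := fun _ _ ↦ rfl
  obtain ⟨e, hμ, hadd₁, hadd₂, halt, hnondeg, hgal⟩ :=
    exists_weilPairing_holds (W.baseChange K) (p ^ 1) (by rw [pow_one]; exact hp.two_le) (by
      rw [pow_one]; exact_mod_cast hp.ne_zero)
  obtain ⟨inv, hinvperf, hPTsum⟩ := poitouTate_sum_localTatePairing_eq_zero_of_isTotallyComplex K (p ^ 1)
  obtain ⟨b, hb⟩ := exists_zmodBilinear_invCupProduct_P W K p e hμ hadd₁ hadd₂ hgal inv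
  have hinj : ∀ v : HeightOneSpectrum (𝓞 K), Injective (inv (Sum.inr v)) := fun v ↦ (hinvperf v).1.1
  have hrec : ∀ (x y : Vp W K p) (T : Finset (Place K)), (∀ v, v ∉ T → b v (loc v x) (loc v y) = 0) →
      ∑ v ∈ T, b v (loc v x) (loc v y) = 0 := fun x y T hT ↦ sum_invCupProduct_eq_zero_P W K p hb hPTsum x y T hT
  have hisoKum := fun v ↦ invCupProduct_eq_zero_of_mem_kummer_P W K p hb halt v
  have hisoTor : ∀ (q : AdmQ W K p) (v : HeightOneSpectrum (𝓞 K)), ((q : ℕ) : 𝓞 K) ∈ v.asIdeal →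
      ∀ (x y : Vp W K p),
      x ∈ toricLocalKer (W.baseChange K) (v.adicCompletion K) ((p ^ 1 : ℕ) : ℤ) →
      y ∈ toricLocalKer (W.baseChange K) (v.adicCompletion K) ((p ^ 1 : ℕ) : ℤ) →
      b (Sum.inr v) (loc (Sum.inr v) x) (loc (Sum.inr v) y) = 0 :=
    fun q v hqv x y hx hy ↦ invCupProduct_eq_zero_of_mem_toric_P W K p hb hK.1 halt q v hqv x y hx hy
  have hisoTr : ∀ (ℓ : {ℓ // Zhang2014.IsKolyvaginPrime (W.conductorNorm ℤ) W K p ℓ}) (x y : Vp W K p),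
      x ∈ transverseLocalKerP W K p ι ℓ (plK ℓ) → y ∈ transverseLocalKerP W K p ι ℓ (plK ℓ) →
      b (Sum.inr (plK ℓ)) (loc (Sum.inr (plK ℓ)) x) (loc (Sum.inr (plK ℓ)) y) = 0 := by
    intro ℓ x y hx hy
    rw [hb, hloc, hloc, cupProduct_eq_zero_of_mem_transverseLocalKerP W K p hK ι hp2 e hμ hadd₁ hadd₂ hgal ℓ ℓ.2
      (plK ℓ) (hplK ℓ) x y hx hy]
    exact (congrArg (ZMod.ringEquivCongr (pow_one p)) (map_zero (inv (Sum.inr (plK ℓ))))).trans (map_zero _)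
  have hjump := hjump_of_poitouTateP W K p hK hp2 hd hPT ι plK hplK
  -- (IsoBound) in `b`-currency from the cup-product currency (`inv_λ` is injective)
  have hcup0 : ∀ (ℓ : {ℓ // Zhang2014.IsKolyvaginPrime (W.conductorNorm ℤ) W K p ℓ}) (x y : Vp W K p),
      b (Sum.inr (plK ℓ)) (loc (Sum.inr (plK ℓ)) x) (loc (Sum.inr (plK ℓ)) y) = 0 →
      (weilContPairingLocal (W.baseChange K) (p ^ 1) e hμ hadd₁ hadd₂ hgal (Sum.inr (plK ℓ))).cupProduct
        (galoisCohomology.localization ((W.baseChange K).torsionGaloisModule ((p ^ 1 : ℕ) : ℤ)) (Sum.inr (plK ℓ)) 1 x)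
        (galoisCohomology.localization ((W.baseChange K).torsionGaloisModule ((p ^ 1 : ℕ) : ℤ)) (Sum.inr (plK ℓ)) 1 y)
          = 0 := by
    intro ℓ x y h
    rw [hb, hloc, hloc] at h
    have h' := (EmbeddingLike.map_eq_zero_iff (f := ZMod.ringEquivCongr (pow_one p))).mp h
    exact hinj _ (h'.trans (map_zero _).symm)
  have hbound : ∀ (ℓ : {ℓ // Zhang2014.IsKolyvaginPrime (W.conductorNorm ℤ) W K p ℓ}) (s : Bool) (x y : Vp W K p),
      conjAct W c ((p ^ 1 : ℕ) : ℤ) x = sgnP s • x → conjAct W c ((p ^ 1 : ℕ) : ℤ) y = sgnP s • y →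
      b (Sum.inr (plK ℓ)) (loc (Sum.inr (plK ℓ)) x) (loc (Sum.inr (plK ℓ)) x) = 0 →
      b (Sum.inr (plK ℓ)) (loc (Sum.inr (plK ℓ)) x) (loc (Sum.inr (plK ℓ)) y) = 0 →
      b (Sum.inr (plK ℓ)) (loc (Sum.inr (plK ℓ)) y) (loc (Sum.inr (plK ℓ)) x) = 0 →
      b (Sum.inr (plK ℓ)) (loc (Sum.inr (plK ℓ)) y) (loc (Sum.inr (plK ℓ)) y) = 0 →
      x ∉ (W.baseChange K).torsionLocalKer ((plK ℓ).adicCompletion K) ((p ^ 1 : ℕ) : ℤ) →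
      ∃ a : ℤ, y - a • x ∈ (W.baseChange K).torsionLocalKer ((plK ℓ).adicCompletion K) ((p ^ 1 : ℕ) : ℤ) :=
    fun ℓ s x y hxs hys h11 h12 h21 h22 hx0 ↦
      sub_zsmul_mem_torsionLocalKer_of_isotropic_P W K p hK hp2 hsurj hc e hμ hadd₁ hadd₂ halt hnondeg hgal ℓ.2 (plK ℓ)
        (hplK ℓ) s hxs hys (hcup0 ℓ x x h11) (hcup0 ℓ x y h12) (hcup0 ℓ y x h21) (hcup0 ℓ y y h22) hx0
  exact supply_signed_of_jump_boundP W K p ι c hK hp2 hc loc hloc plK hplK b hrec hisoKum hisoTor hisoTr hjump hbound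

/-! ## §2 (Supply) in the place currency of `KolyvaginLocalPackageP.supply`, and LOC modulo Poitou–Tate -/

/-- **(Supply) — verbatim the field `KolyvaginLocalPackageP.supply`** — at a ♯-type frame with `d_K < −4`, from the
Poitou–Tate fact: `hSupply_of_poitouTateP` with `plK ℓ := (ℓ)`, the unique place above the inert Kolyvagin prime.
[cite: WZhang2014, Lemma 8.2] -/
theorem supply_of_poitouTateP (hK : IsImaginaryQuadratic K) (hp2 : p ≠ 2) (hd : NumberField.discr K < -4)
    (hsurj : W.HasSurjectiveModNGaloisRep p) (hc : c ≠ 1) (hPT : poitouTate_selmerStructure_duality K) :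
    ∀ (n : Finset (AdmQ W K p)), n.Nonempty →
      ∀ (ℓ : {ℓ // Zhang2014.IsKolyvaginPrime (W.conductorNorm ℤ) W K p ℓ})
        (T : Finset {ℓ // Zhang2014.IsKolyvaginPrime (W.conductorNorm ℤ) W K p ℓ}), ℓ ∉ T →
      ∀ s : Bool, ∃ x : Vp W K p, conjAct W c ((p ^ 1 : ℕ) : ℤ) x = sgnP s • x ∧ x ≠ 0 ∧
        (∀ w : InfinitePlace K, x ∈ selmerLocalKer (W.baseChange K) w.Completion ((p ^ 1 : ℕ) : ℤ)) ∧
        (∀ v : HeightOneSpectrum (𝓞 K), ((ℓ : ℕ) : 𝓞 K) ∉ v.asIdeal →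
          (∀ ℓ' ∈ T, ((ℓ' : ℕ) : 𝓞 K) ∉ v.asIdeal) →
          ((∀ q ∈ n, ((q : ℕ) : 𝓞 K) ∉ v.asIdeal) →
            x ∈ selmerLocalKer (W.baseChange K) (v.adicCompletion K) ((p ^ 1 : ℕ) : ℤ)) ∧
          (∀ q ∈ n, ((q : ℕ) : 𝓞 K) ∈ v.asIdeal →
            x ∈ toricLocalKer (W.baseChange K) (v.adicCompletion K) ((p ^ 1 : ℕ) : ℤ))) ∧
        (∀ ℓ' ∈ T, ∀ v : HeightOneSpectrum (𝓞 K), ((ℓ' : ℕ) : 𝓞 K) ∈ v.asIdeal →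
          x ∈ transverseLocalKerP W K p ι ℓ' v) := by
  intro n hn ℓ T hℓT s
  -- the places `λ = (ℓ)` of the (inert) Kolyvagin primes
  let plK : {ℓ // Zhang2014.IsKolyvaginPrime (W.conductorNorm ℤ) W K p ℓ} → HeightOneSpectrum (𝓞 K) := fun ℓ ↦
    ⟨Ideal.span {((ℓ : ℕ) : 𝓞 K)}, ℓ.2.2.2.2.2.1, by
      rw [Ne, Ideal.span_singleton_eq_bot]; exact_mod_cast ℓ.2.1.ne_zero⟩
  have hplK : ∀ ℓ, ((ℓ : ℕ) : 𝓞 K) ∈ (plK ℓ).asIdeal := fun ℓ ↦ Ideal.mem_span_singleton_self _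
  have hcur := ne_plK_iff_not_mem W K p plK hplK
  obtain ⟨x, hxs, hx0, hinf, hfin, htr⟩ :=
    hSupply_of_poitouTateP W K p ι c hK hp2 hd hsurj hc hPT plK hplK n hn ℓ T hℓT s
  refine ⟨x, hxs, hx0, hinf, fun v hv hvT ↦ hfin v ((hcur ℓ v).mpr hv)
    (fun ℓ' hℓ' ↦ ((hcur ℓ' v).mpr (hvT ℓ' hℓ')).symm), fun ℓ' hℓ' v hv ↦ ?_⟩
  have hveq : v = plK ℓ' := by
    by_contra hne
    exact (hcur ℓ' v).mp hne hv
  rw [hveq]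
  exact htr ℓ' hℓ'

/-- **Stub LOC modulo the Poitou–Tate fact** (and `d_K < −4`): the local–global package `KolyvaginLocalPackageP W K p ι c`
of W. Zhang's induction EXISTS at a ♯-type frame (`K` imaginary quadratic with `d_K < −4`, `p` odd, `ρ̄_{E,p}` onto,
`c ≠ 1`), granted `poitouTate_selmerStructure_duality K` (Milne ADT I Thm. 4.10; Rubin Thm. 1.7.3). akr-p1 g3's
`kolyvaginLocalPackageP_of_supply` (p540947: `b = inv ∘ ∪`, (REC), Kummer ∕ toric ∕ transverse isotropy, (Perf), (Line) in
the kernel) fed with `supply_of_poitouTateP`. [cite: WZhang2014, §8.1, Lemma 8.1, Lemma 8.2, Lemma 8.4]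
[cite: MilneADT2006, Ch. I, Cor. 2.3, Thm. 4.10] [cite: GrossLMS1991, Prop. 8.1, Prop. 9.6] -/
theorem kolyvaginLocalPackageP_of_poitouTate (hK : IsImaginaryQuadratic K) (hp2 : p ≠ 2)
    (hd : NumberField.discr K < -4) (hsurj : W.HasSurjectiveModNGaloisRep p) (hc : c ≠ 1)
    (hPT : poitouTate_selmerStructure_duality K) :
    Nonempty (KolyvaginLocalPackageP W K p ι c) :=
  kolyvaginLocalPackageP_of_supply W K p ι c hK hp2 hsurj hc (supply_of_poitouTateP W K p ι c hK hp2 hd hsurj hc hPT)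

end Summit.BirchSwinnertonDyer.BirchSwinnertonDyer.Theorems.AdditiveKoly

end
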